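import Summits.KontsevichZagierPeriods.KontsevichZagierPeriods.Theorems.RootDecompWalshStrataBallRegions

/-!
# Ball-cube descent 3/7: rule (2) along the chart; rule (3) in `x` over a semialgebraic base; the Euler chart of `x² + y² = 3/4`

Gen 5 of the decomposition node `WalshStrata` (route `RootDecompWalshStrata`, support item
`QuadricBakerDescent` stmt-KontsevichZagierPeriods-27597, its `d = 3` slice): the first two-variable
`√(quadratic)` weight over CUBE-CUT cells decided inside KZ's rules (1)–(3) over `ℚ` —
`sqrtDescent₂_ball : ∀ γ, SqrtDescent₂ K₇ γ` (part 6) for the ball quadric `P = 7/4 − x² − y² − z²`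
(`D = 7 − 4x² − 4y²`; atoms = the disc `x² + y² < 3/4` and the annulus `3/4 < x² + y² < 7/4` cut by
the faces `x = 1`, `y = 1`, plus null/empty/zero-weight atoms), and the corollary
`ballCube_bakerDescent` (part 7): `(d, P, q) = (3, 7/4 − Σxᵢ², q)` is an instance of
`QuadricBakerDescent` for every `q ∈ ℚ`.  Mechanism: the fibrewise vertex chart
`(v, x) ↦ (x, s(x)·v/(1 + v²))`, `s = √(7 − 4x²)`, makes `√D·|det| = (7 − 4x²)(1 − v²)²/(1 + v²)³`
RATIONAL; Newton–Leibniz in `x` over an arbitrary semialgebraic base (the landed band identity); the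
`√(7 − 4x²)`-CANCELLATION on the algebraic edges `x² = β(v)` (circle) and `x² = α(v)` (face `y = 1`)
under the charts `v₁ = 2p/(s + 2)`, `v₂ = 2/(s + 2p)` (`p = √(3/4 − x²)`) reduces both boundary terms to
`E(x²)·√(3/4 − x²)`, `E ∈ ℚ(X)`, hence to rational integrands by the Euler chart of `x² + y² = 3/4`.
This part: `vxRep`/`sqrtDRep` and `[S, c(7 − 4x²)g(v)] ≡ [Φ(S), c√D]` (rule (2),
`KZ.changeOfVariablesRel_subset_relations`); the primitive `F(t, v) = c(7t − 4t³/3)g(v)` and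
`band_move` (the landed band identity `of_bandRep_sub_of_lenRep_mem_relations` one level down:
`[oband B l u, c(7 − 4x²)g] ≡ [B, F(u,·) − F(l,·)]`); `inBaker_of_euler34`: a weight
`E(x²)·√(3/4 − x²)` with `E ∈ ℚ(X)` is in the Baker sector via `x = ρ(1 − w²)/(1 + w²)`, `ρ = √(3/4)`
(rule (2) with a `ℚ`-semialgebraic chart of algebraic-irrational scale).  Imports: part 2; 0 sorry.
[KontsevichZagier2001 §1.2; BCR1998 §2.2]
-/

noncomputable section

open Literature.NumberTheory.Transcendental
open MeasureTheory Set
open MvPolynomial (aeval X C)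
open Literature.ModelTheory.ExponentialFields (IsSemialgebraic isSemialgebraic_univ
  isSemialgebraic_setOf_eval_pos isSemialgebraic_setOf_eval_lt isSemialgebraic_setOf_eval_le
  isSemialgebraic_setOf_eval_nonneg isSemialgebraic_setOf_eval_eq_zero continuous_aeval_real
  tarski_seidenberg_real_holds)
open Summit.KontsevichZagierPeriods.RootDecompWalshStrata.WalshSpanProof (isSemialgebraic_cubeSet
  isBounded_cubeSet)
open Summit.KontsevichZagierPeriods.RootDecompWalshStrata.ConeSpecimen (unitIoo isSemialgebraic_unitIoo
  unitIoo_subset_Icc mem_unitIoo)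
open Summit.KontsevichZagierPeriods.RootDecompWalshStrata.PointlessOctant (boxTwo isSemialgebraic_boxTwo
  boxTwo_subset_Icc euler_inj)

namespace Summit.KontsevichZagierPeriods.RootDecompWalshStrata.ConicDescent.BallCube

/-! #### 23.6 Rule (2): `[S, c(7 − 4x²)g(v)] ≡ [Φ(S), c√(7 − 4x² − 4y²)]` -/

/-- `Fin.snoc u t 1 = t` on `Fin 2` (file-local rfl helper). [folklore] -/
@[simp] private theorem snoc₁_apply_one (u : Fin 1 → ℝ) (t : ℝ) : (Fin.snoc u t : Fin 2 → ℝ) 1 = t := rfl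

/-- `Fin.snoc u t 0 = u 0` on `Fin 2` (file-local rfl helper). [folklore] -/
@[simp] private theorem snoc₁_apply_zero (u : Fin 1 → ℝ) (t : ℝ) : (Fin.snoc u t : Fin 2 → ℝ) 0 = u 0 := rfl

/-- `d/ds (1 − s²)/(1 + s²) = −4s/(1+s²)²` (file-local copy; a twin lives in an unbuilt module). [calculus] -/
private theorem hasDerivAt_euler (s : ℝ) :
    HasDerivAt (fun s : ℝ => (1 - s ^ 2) / (1 + s ^ 2)) (-(4 * s) / (1 + s ^ 2) ^ 2) s := by
  have h1 : HasDerivAt (fun s : ℝ => 1 - s ^ 2) (-(2 * s)) s := by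
    simpa using (hasDerivAt_pow 2 s).const_sub 1
  have h2 : HasDerivAt (fun s : ℝ => 1 + s ^ 2) (2 * s) s := by
    simpa using (hasDerivAt_pow 2 s).const_add 1
  have hne : (1 + s ^ 2) ≠ 0 := by positivity
  exact (h1.div h2 hne).congr_deriv (by field_simp; ring)

/-- Lemma `abs_weight_le` of the ball-cube descent (gen 5; see the section docstring). [this node] -/
theorem abs_weight_le (c : ℚ) {x v : ℝ} (hx0 : 0 ≤ x) (hx1 : x ≤ 1) (hv0 : 0 ≤ v) (hv1 : v ≤ 1) :
    |(c : ℝ) * (7 - 4 * x ^ 2) * chG v| ≤ |(c : ℝ)| * 7 := by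
  rw [abs_mul, abs_mul, abs_of_nonneg (chG_nonneg v)]
  have h7 : |(7:ℝ) - 4 * x ^ 2| ≤ 7 := by
    rw [abs_le]; constructor <;> nlinarith [mul_nonneg hx0 hx0, mul_le_one₀ hx1 hx0 hx1]
  calc |(c : ℝ)| * |7 - 4 * x ^ 2| * chG v ≤ |(c : ℝ)| * 7 * 1 :=
        mul_le_mul (mul_le_mul_of_nonneg_left h7 (abs_nonneg _)) (chG_le_one hv0 hv1) (chG_nonneg v)
          (by positivity)
    _ = |(c : ℝ)| * 7 := mul_one _

/-- The chart weight `c(7 − 4x²)g(v)` (`p 0 = v`, `p 1 = x`) is `ℚ`-semialgebraic (rational). -/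
theorem isSemialgebraicFunOn_weight {S : Set (Fin 2 → ℝ)} (hS : IsSemialgebraic ℚ S) (c : ℚ) :
    IsSemialgebraicFunOn ℚ S fun p => (c : ℝ) * (7 - 4 * p 1 ^ 2) * chG (p 0) :=
  (isSemialgebraicFunOn_aeval_div_aeval hS
      (MvPolynomial.C c * (7 - 4 * X 1 ^ 2) * (1 - X 0 ^ 2) ^ 2) ((1 + X 0 ^ 2) ^ 3)
      fun p _ => by
        have h : (0:ℝ) < (1 + p 0 ^ 2) ^ 3 := by positivity
        simpa using h.ne').congr fun p _ => by
    simp only [map_mul, map_sub, map_pow, map_add, map_one, MvPolynomial.aeval_C,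
      MvPolynomial.aeval_X, map_ofNat, eq_ratCast, chG]
    ring

/-- `[S, c(7 − 4x²)g(v)]` on a piece `S ⊆ (0,1)²` of the chart plane. -/
def vxRep (S : Set (Fin 2 → ℝ)) (hS : IsSemialgebraic ℚ S) (hSb : S ⊆ boxTwo) (c : ℚ) :
    KZ.IntegralRep 2 :=
  bddRep S hS ((isCompact_Icc (a := (0 : Fin 2 → ℝ)) (b := 1)).isBounded.subset
      (hSb.trans boxTwo_subset_Icc))
    (fun p => (c : ℝ) * (7 - 4 * p 1 ^ 2) * chG (p 0)) (isSemialgebraicFunOn_weight hS c)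
    (|(c : ℝ)| * 7) fun p hp => by
      have hb := hSb hp
      exact abs_weight_le c (hb 1).1.le (hb 1).2.le (hb 0).1.le (hb 0).2.le

/-- Lemma `vxRep_domain` of the ball-cube descent (gen 5; see the section docstring). [this node] -/
@[simp] theorem vxRep_domain (S : Set (Fin 2 → ℝ)) (hS : IsSemialgebraic ℚ S) (hSb : S ⊆ boxTwo)
    (c : ℚ) : (vxRep S hS hSb c).domain = S := rfl

/-- Lemma `vxRep_integrand` of the ball-cube descent (gen 5; see the section docstring). [this node] -/
@[simp] theorem vxRep_integrand (S : Set (Fin 2 → ℝ)) (hS : IsSemialgebraic ℚ S) (hSb : S ⊆ boxTwo)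
    (c : ℚ) (p : Fin 2 → ℝ) :
    (vxRep S hS hSb c).integrand p = (c : ℝ) * (7 - 4 * p 1 ^ 2) * chG (p 0) := rfl

/-- `[T, c√(7 − 4x² − 4y²)]` on a piece `T ⊆ (0,1)²` of the `(x, y)`-plane. -/
def sqrtDRep (T : Set (Fin 2 → ℝ)) (hT : IsSemialgebraic ℚ T) (hTb : T ⊆ boxTwo) (c : ℚ) :
    KZ.IntegralRep 2 :=
  bddRep T hT ((isCompact_Icc (a := (0 : Fin 2 → ℝ)) (b := 1)).isBounded.subset
      (hTb.trans boxTwo_subset_Icc))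
    (fun u => (c : ℝ) * √(7 - 4 * u 0 ^ 2 - 4 * u 1 ^ 2))
    ((IsSemialgebraicFunOn.mul_holds (isSemialgebraicFunOn_ratCast hT c)
      (IsSemialgebraicFunOn.sqrt_holds
        (isSemialgebraicFunOn_aeval hT (7 - 4 * X 0 ^ 2 - 4 * X 1 ^ 2)))).congr fun u _ => by
      simp only [Pi.mul_apply, map_sub, map_mul, map_pow, MvPolynomial.aeval_X, map_ofNat])
    (|(c : ℝ)| * √7) fun u _ => by
      rw [abs_mul, abs_of_nonneg (Real.sqrt_nonneg _)]
      exact mul_le_mul_of_nonneg_left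
        (Real.sqrt_le_sqrt (by nlinarith [sq_nonneg (u 0), sq_nonneg (u 1)])) (abs_nonneg _)

/-- Lemma `sqrtDRep_domain` of the ball-cube descent (gen 5; see the section docstring). [this node] -/
@[simp] theorem sqrtDRep_domain (T : Set (Fin 2 → ℝ)) (hT : IsSemialgebraic ℚ T) (hTb : T ⊆ boxTwo)
    (c : ℚ) : (sqrtDRep T hT hTb c).domain = T := rfl

/-- Lemma `sqrtDRep_integrand` of the ball-cube descent (gen 5; see the section docstring). [this node] -/
@[simp] theorem sqrtDRep_integrand (T : Set (Fin 2 → ℝ)) (hT : IsSemialgebraic ℚ T)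
    (hTb : T ⊆ boxTwo) (c : ℚ) (u : Fin 2 → ℝ) :
    (sqrtDRep T hT hTb c).integrand u = (c : ℝ) * √(7 - 4 * u 0 ^ 2 - 4 * u 1 ^ 2) := rfl

/-- **Move (2), the fibrewise vertex chart:** `[S, c(7 − 4x²)g(v)] − [Φ(S), c√(7 − 4x² − 4y²)]
∈ relations` for every semialgebraic `S ⊆ (0,1)²` (`√D ∘ Φ = s(1 − v²)/(1 + v²)`,
`|det Φ'| = s(1 − v²)/(1 + v²)²`, `s² = 7 − 4x²`). [KontsevichZagier2001 §1.2 rule (2)] -/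
theorem vxRep_sub_sqrtDRep_mem_relations (S T : Set (Fin 2 → ℝ)) (hS : IsSemialgebraic ℚ S)
    (hSb : S ⊆ boxTwo) (hT : IsSemialgebraic ℚ T) (hTb : T ⊆ boxTwo) (himg : chΦ '' S = T) (c : ℚ) :
    KZ.of (vxRep S hS hSb c) - KZ.of (sqrtDRep T hT hTb c) ∈ KZ.relations := by
  refine KZ.changeOfVariablesRel_subset_relations
    ⟨2, vxRep S hS hSb c, sqrtDRep T hT hTb c, chΦ, chΦ', ?_,
      fun p hp => (hasFDerivAt_chΦ p ?_).hasFDerivWithinAt, injOn_chΦ.mono hSb, ?_,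
      fun p hp => ?_, rfl⟩
  · refine IsSemialgebraicMapOn.of_forall hS fun j => ?_
    fin_cases j
    · exact (isSemialgebraicFunOn_apply hS 1).congr fun p _ => by simp
    · exact ((IsSemialgebraicFunOn.sqrt_holds (isSemialgebraicFunOn_aeval hS (7 - 4 * X 1 ^ 2))).mul_holds
          (isSemialgebraicFunOn_aeval_div_aeval hS (X 0) (1 + X 0 ^ 2) fun p _ => by
            have h : (0:ℝ) < 1 + p 0 ^ 2 := by positivity
            simpa using h.ne')).congr fun p _ => by
          simp [chS]
  · have hb := hSb hp; have h1 := hb 1; nlinarith [h1.1, h1.2]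
  · show T = chΦ '' S
    exact himg.symm
  · have hb := hSb hp; have hp0 := hb 0; have hp1 := hb 1
    have hx74 : p 1 ^ 2 ≤ 7 / 4 := by nlinarith [hp1.1, hp1.2]
    have hv2 : p 0 ^ 2 ≤ 1 := by nlinarith [hp0.1, hp0.2]
    have hdet : (chΦ' p).det ≤ 0 := by
      rw [chΦ'_det]
      exact neg_nonpos.2 (mul_nonneg (chS_nonneg _) (div_nonneg (by nlinarith) (by positivity)))
    show (c : ℝ) * (7 - 4 * p 1 ^ 2) * chG (p 0) =
      (c : ℝ) * √(7 - 4 * (chΦ p 0) ^ 2 - 4 * (chΦ p 1) ^ 2) * |(chΦ' p).det|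
    rw [abs_of_nonpos hdet, chΦ'_det, neg_neg, chΦ_zero, chΦ_one, chart_sqrtD (p 1) (p 0) hx74 hv2,
      ← chS_sq hx74, chG]
    have h : (1 + p 0 ^ 2) ≠ 0 := by positivity
    field_simp

/-! #### 23.7 Rule (3) in `x`: the primitive `F(t, v) = c(7t − 4t³/3)g(v)` -/

/-- The primitive `F(t, v) = c(7t − 4t³/3)g(v)` of the chart weight in `t = x`. -/
def chF (c : ℚ) (t v : ℝ) : ℝ := (c : ℝ) * (7 * t - 4 / 3 * t ^ 3) * chG v

/-- Lemma `chF_zero` of the ball-cube descent (gen 5; see the section docstring). [this node] -/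
@[simp] theorem chF_zero (c : ℚ) (v : ℝ) : chF c 0 v = 0 := by simp [chF]

/-- Lemma `chF_neg` of the ball-cube descent (gen 5; see the section docstring). [this node] -/
theorem chF_neg (c : ℚ) (t v : ℝ) : chF (-c) t v = -chF c t v := by
  simp only [chF]; push_cast; ring

/-- Lemma `abs_chF_le` of the ball-cube descent (gen 5; see the section docstring). [this node] -/
theorem abs_chF_le (c : ℚ) {t v : ℝ} (ht0 : 0 ≤ t) (ht1 : t ≤ 1) (hv0 : 0 ≤ v) (hv1 : v ≤ 1) :
    |chF c t v| ≤ |(c : ℝ)| * 9 := by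
  rw [chF, abs_mul, abs_mul, abs_of_nonneg (chG_nonneg v)]
  have h3 : t ^ 3 ≤ 1 := pow_le_one₀ ht0 ht1
  have h3' : 0 ≤ t ^ 3 := pow_nonneg ht0 3
  have h1 : |7 * t - 4 / 3 * t ^ 3| ≤ 9 := by rw [abs_le]; constructor <;> nlinarith
  calc |(c : ℝ)| * |7 * t - 4 / 3 * t ^ 3| * chG v ≤ |(c : ℝ)| * 9 * 1 :=
        mul_le_mul (mul_le_mul_of_nonneg_left h1 (abs_nonneg _)) (chG_le_one hv0 hv1) (chG_nonneg v)
          (by positivity)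
    _ = |(c : ℝ)| * 9 := mul_one _

/-- `∂F/∂t = c(7 − 4t²)g(v)`. [calculus] -/
theorem hasDerivAt_chF (c : ℚ) (t v : ℝ) :
    HasDerivAt (fun t => chF c t v) ((c : ℝ) * (7 - 4 * t ^ 2) * chG v) t := by
  have ha : HasDerivAt (fun t : ℝ => 7 * t) (7 * 1) t := (hasDerivAt_id t).const_mul 7
  have hb : HasDerivAt (fun t : ℝ => 4 / 3 * t ^ 3) (4 / 3 * (↑(3 : ℕ) * t ^ (3 - 1))) t :=
    (hasDerivAt_pow 3 t).const_mul (4 / 3)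
  have h1 : HasDerivAt (fun t : ℝ => 7 * t - 4 / 3 * t ^ 3) (7 - 4 * t ^ 2) t :=
    (ha.sub hb).congr_deriv (by push_cast; ring)
  exact (h1.const_mul (c : ℝ)).mul_const (chG v)

/-- Lemma `continuous_chF` of the ball-cube descent (gen 5; see the section docstring). [this node] -/
theorem continuous_chF (c : ℚ) (v : ℝ) : Continuous fun t => chF c t v := by
  unfold chF; fun_prop

/-- Lemma `isSemialgebraicFunOn_chG` of the ball-cube descent (gen 5; see the section docstring). [this node] -/
theorem isSemialgebraicFunOn_chG {B : Set (Fin 1 → ℝ)} (hB : IsSemialgebraic ℚ B) :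
    IsSemialgebraicFunOn ℚ B fun w => chG (w 0) :=
  (isSemialgebraicFunOn_aeval_div_aeval hB ((1 - X 0 ^ 2) ^ 2) ((1 + X 0 ^ 2) ^ 3) fun w _ => by
      have h : (0:ℝ) < (1 + w 0 ^ 2) ^ 3 := by positivity
      simpa using h.ne').congr fun w _ => by
    simp only [map_pow, map_sub, map_add, map_one, MvPolynomial.aeval_X, chG]

/-- `v ↦ F(u(v), v)` is semialgebraic for a semialgebraic `u`. -/
theorem isSemialgebraicFunOn_chF {B : Set (Fin 1 → ℝ)} (hB : IsSemialgebraic ℚ B)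
    {u : (Fin 1 → ℝ) → ℝ} (hu : IsSemialgebraicFunOn ℚ B u) (c : ℚ) :
    IsSemialgebraicFunOn ℚ B fun w => chF c (u w) (w 0) := by
  have h3 : IsSemialgebraicFunOn ℚ B (u * u * u) := (hu.mul_holds hu).mul_holds hu
  have hp : IsSemialgebraicFunOn ℚ B ((fun _ => ((7 : ℚ) : ℝ)) * u -
      (fun _ => ((4 / 3 : ℚ) : ℝ)) * (u * u * u)) :=
    IsSemialgebraicFunOn.sub_holds ((isSemialgebraicFunOn_ratCast hB 7).mul_holds hu)
      ((isSemialgebraicFunOn_ratCast hB (4 / 3)).mul_holds h3)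
  exact (((isSemialgebraicFunOn_ratCast hB c).mul_holds hp).mul_holds
    (isSemialgebraicFunOn_chG hB)).congr fun w _ => by
      simp only [chF, Pi.mul_apply, Pi.sub_apply]; push_cast; ring

/-- **Rule (3) in `x`** for the chart weight over a base `X ⊆ [0,1]` with semialgebraic edges
`0 ≤ l ≤ u ≤ 1`: `[oband X l u, c(7 − 4x²)g(v)] ≡ [X, F(u(v), v) − F(l(v), v)]` (Newton–Leibniz on
the closed band, whose edges are null). [KontsevichZagier2001 §1.2 rules (1), (3)] -/
theorem band_move {B : Set (Fin 1 → ℝ)} (hBs : IsSemialgebraic ℚ B) (hB : B ⊆ Icc 0 1)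
    {l u : (Fin 1 → ℝ) → ℝ} (hl : IsSemialgebraicFunOn ℚ B l) (hu : IsSemialgebraicFunOn ℚ B u)
    (hl0 : ∀ w ∈ B, 0 ≤ l w) (hlu : ∀ w ∈ B, l w ≤ u w) (hu1 : ∀ w ∈ B, u w ≤ 1) (c : ℚ)
    (ρ : KZ.IntegralRep 2) (hρd : ρ.domain = oband B l u)
    (hρi : ∀ z ∈ ρ.domain, ρ.integrand z = (c : ℝ) * (7 - 4 * z 1 ^ 2) * chG (z 0))
    (τ : KZ.IntegralRep 1) (hτd : τ.domain = B)
    (hτi : ∀ w ∈ B, τ.integrand w = chF c (u w) (w 0) - chF c (l w) (w 0)) :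
    KZ.of ρ - KZ.of τ ∈ KZ.relations := by
  have hband : IsSemialgebraic ℚ (KZlog.band B l u) := KZlog.isSemialgebraic_band hl hu
  have hbandI : KZlog.band B l u ⊆ Icc 0 1 := by
    intro z hz
    rw [KZlog.mem_band] at hz
    obtain ⟨hzX, h1, h2⟩ := hz
    have hI := hB hzX
    refine ⟨fun j => ?_, fun j => ?_⟩
    · refine Fin.lastCases ?_ (fun i => ?_) j
      · exact (hl0 _ hzX).trans h1
      · simpa [Fin.init] using hI.1 i
    · refine Fin.lastCases ?_ (fun i => ?_) j
      · exact h2.trans (hu1 _ hzX)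
      · simpa [Fin.init] using hI.2 i
  have hbandb : Bornology.IsBounded (KZlog.band B l u) :=
    (isCompact_Icc (a := (0 : Fin 2 → ℝ)) (b := 1)).isBounded.subset hbandI
  have hBb : Bornology.IsBounded B := (isCompact_Icc (a := (0 : Fin 1 → ℝ)) (b := 1)).isBounded.subset hB
  have hF : IsSemialgebraicFunOn ℚ (KZlog.band B l u) fun z => chF c (z 1) (z 0) :=
    (isSemialgebraicFunOn_aeval_div_aeval hband
      (MvPolynomial.C c * (7 * X 1 - MvPolynomial.C (4 / 3) * X 1 ^ 3) * (1 - X 0 ^ 2) ^ 2)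
      ((1 + X 0 ^ 2) ^ 3) fun z _ => by
        have h : (0:ℝ) < (1 + z 0 ^ 2) ^ 3 := by positivity
        simpa using h.ne').congr fun z _ => by
      simp only [map_mul, map_sub, map_pow, map_add, map_one, MvPolynomial.aeval_C,
        MvPolynomial.aeval_X, map_ofNat, eq_ratCast, chF, chG]
      push_cast; ring
  have hf : IsSemialgebraicFunOn ℚ (KZlog.band B l u) fun z => (c : ℝ) * (7 - 4 * z 1 ^ 2) * chG (z 0) :=
    isSemialgebraicFunOn_weight hband c
  have hds : IsSemialgebraicFunOn ℚ B fun w => chF c (u w) (w 0) - chF c (l w) (w 0) :=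
    IsSemialgebraicFunOn.sub_holds (isSemialgebraicFunOn_chF hBs hu c) (isSemialgebraicFunOn_chF hBs hl c)
  have hbd : ∀ w ∈ B, |chF c (u w) (w 0) - chF c (l w) (w 0)| ≤ |(c : ℝ)| * 9 + |(c : ℝ)| * 9 := by
    intro w hw
    have hI := hB hw
    have hw0 : 0 ≤ w 0 := hI.1 0
    have hw1 : w 0 ≤ 1 := hI.2 0
    have hl0' := hl0 w hw; have hlu' := hlu w hw; have hu1' := hu1 w hw
    exact (abs_sub _ _).trans (add_le_add (abs_chF_le c (hl0'.trans hlu') hu1' hw0 hw1)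
      (abs_chF_le c hl0' (hlu'.trans hu1') hw0 hw1))
  obtain ⟨rb, rd, hrbd, hrbi, hrdd, hrdi, hrel⟩ := KZ.exists_band_newtonLeibniz hBs l u hl hu hlu
    (fun z => chF c (z 1) (z 0)) (fun z => (c : ℝ) * (7 - 4 * z 1 ^ 2) * chG (z 0)) hF hf
    (fun w _ => by
      simp only [snoc₁_apply_one, snoc₁_apply_zero]
      exact (continuous_chF c (w 0)).continuousOn)
    (fun w _ t _ => by
      simp only [snoc₁_apply_one, snoc₁_apply_zero]
      exact hasDerivAt_chF c t (w 0))
    (integrableOn_of_bdd hband hbandb hf (|(c : ℝ)| * 7) fun z hz => by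
      have hI := hbandI hz
      exact abs_weight_le c (hI.1 1) (hI.2 1) (hI.1 0) (hI.2 0))
    (hds.congr fun w _ => by simp only [snoc₁_apply_one, snoc₁_apply_zero])
    ((integrableOn_of_bdd hBs hBb hds _ hbd).congr_fun
      (fun w _ => by simp only [snoc₁_apply_one, snoc₁_apply_zero]) hBs.measurableSet_holds)
  obtain ⟨r', hr'd, hr'i, hrel'⟩ := KZ.of_sub_of_restrict_openBand_mem_relations hl hu rb hrbd
  have h1 : KZ.of ρ - KZ.of r' ∈ KZ.relations :=
    KZ.of_sub_of_mem_relations_of_eqOn (by rw [hr'd, hρd]; rfl) fun z hz => by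
      rw [hr'i, hrbi, hρi z hz]
  have h2 : KZ.of rd - KZ.of τ ∈ KZ.relations :=
    KZ.of_sub_of_mem_relations_of_eqOn (by rw [hrdd, hτd]) fun w hw => by
      rw [hrdd] at hw
      rw [hrdi, hτi w hw]
      simp only [snoc₁_apply_one, snoc₁_apply_zero]
  have : KZ.of ρ - KZ.of τ =
      (KZ.of ρ - KZ.of r') - (KZ.of rb - KZ.of r') + (KZ.of rb - KZ.of rd) + (KZ.of rd - KZ.of τ) := by
    abel
  rw [this]
  exact KZ.relations.add_mem (KZ.relations.add_mem (KZ.relations.sub_mem h1 hrel') hrel) h2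

/-! #### 23.8 Rule (2) along the Euler chart of the circle `x² + y² = 3/4` -/

/-- `ρ = √(3/4) = √3/2`. -/
def rho : ℝ := √(3 / 4)

/-- Lemma `rho_pos` of the ball-cube descent (gen 5; see the section docstring). [this node] -/
theorem rho_pos : 0 < rho := Real.sqrt_pos.2 (by norm_num)

/-- Lemma `rho_sq` of the ball-cube descent (gen 5; see the section docstring). [this node] -/
theorem rho_sq : rho ^ 2 = 3 / 4 := Real.sq_sqrt (by norm_num)

/-- **Rule (2) along the Euler chart `x = ρ(1 − w²)/(1 + w²)`, `ρ = √3/2`.**  A one-dimensional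
representation on a domain inside `{0 < x, x² < 3/4}` with integrand `E(x²)·√(3/4 − x²)` lands in
the Baker sector as soon as the pull-back `E(3(1 − w²)²/(4(1 + w²)²))·6w²/(1 + w²)³` is a rational
function `p/q` over `ℚ` on `0 < w < 1` (`√(3/4 − x²) = √3·w/(1 + w²)`,
`|dx/dw| = √3·2w/(1 + w²)²`: the two `√3` multiply to `3`). [KontsevichZagier2001 §1.2 rule (2)] -/
theorem inBaker_of_euler34 (r : KZ.IntegralRep 1) (E : ℝ → ℝ)
    (hdom : ∀ x ∈ r.domain, 0 < x 0 ∧ x 0 ^ 2 < 3 / 4)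
    (hr : ∀ x ∈ r.domain, r.integrand x = E (x 0 ^ 2) * √(3 / 4 - x 0 ^ 2))
    (p q : MvPolynomial (Fin 1) ℚ) (hq : ∀ w ∈ unitIoo, aeval w q ≠ 0)
    (hpq : ∀ w ∈ unitIoo, aeval w p / aeval w q =
      E (3 / 4 * ((1 - w 0 ^ 2) / (1 + w 0 ^ 2)) ^ 2) * (6 * w 0 ^ 2 / (1 + w 0 ^ 2) ^ 3)) :
    InBaker (KZ.of r) := by
  have hden : ∀ s : ℝ, 0 < 1 + s ^ 2 := fun s => by positivity
  refine InBaker.of_cov₁ r isSemialgebraic_unitIoo (fun s => rho * ((1 - s ^ 2) / (1 + s ^ 2)))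
    (fun s => rho * (-(4 * s) / (1 + s ^ 2) ^ 2)) ?_ ?_ ?_ ?_ p q hq fun w hw hwd => ?_
  · -- semialgebraic (the irrational constant `ρ = √(3/4)` is `ℚ`-semialgebraic)
    have hρ : IsSemialgebraicFunOn ℚ unitIoo fun _ => rho :=
      (IsSemialgebraicFunOn.sqrt_holds (isSemialgebraicFunOn_ratCast isSemialgebraic_unitIoo
        (3 / 4))).congr fun v _ => by simp only [rho]; push_cast; ring_nf
    have hW : IsSemialgebraicFunOn ℚ unitIoo fun v => (1 - v 0 ^ 2) / (1 + v 0 ^ 2) :=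
      (isSemialgebraicFunOn_aeval_div_aeval isSemialgebraic_unitIoo (1 - X 0 ^ 2) (1 + X 0 ^ 2)
        fun v _ => by
          simp only [map_add, map_one, map_pow, MvPolynomial.aeval_X]
          exact (hden (v 0)).ne').congr fun v _ => by
        simp only [map_sub, map_add, map_one, map_pow, MvPolynomial.aeval_X]
    exact (hρ.mul_holds hW).congr fun v _ => by simp only [Pi.mul_apply]
  · -- derivative
    intro v _
    exact (hasDerivAt_euler (v 0)).const_mul rho
  · -- injective on `(0,1)`
    intro s hs t ht hst
    exact euler_inj (mem_unitIoo.1 hs).1 (mem_unitIoo.1 ht).1 (mul_left_cancel₀ rho_pos.ne' hst)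
  · -- surjective onto the domain
    intro x hx
    obtain ⟨hx0, hx2⟩ := hdom x hx
    have hxρ : x 0 < rho := by
      have h : x 0 ^ 2 < rho ^ 2 := by rw [rho_sq]; exact hx2
      exact (pow_lt_pow_iff_left₀ hx0.le rho_pos.le two_ne_zero).1 h
    have hpu : 0 < rho + x 0 := by linarith [rho_pos]
    have hmu : 0 < rho - x 0 := by linarith
    set w : ℝ := √((rho - x 0) / (rho + x 0)) with hwdef
    have hwpos : 0 < w := Real.sqrt_pos.2 (div_pos hmu hpu)
    have hw2 : w ^ 2 = (rho - x 0) / (rho + x 0) := Real.sq_sqrt (div_pos hmu hpu).le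
    have hw1 : w < 1 := by
      have h : w ^ 2 < 1 := by rw [hw2, div_lt_one hpu]; linarith
      nlinarith
    refine ⟨fun _ => w, mem_unitIoo.2 ⟨hwpos, hw1⟩, ?_⟩
    change rho * ((1 - w ^ 2) / (1 + w ^ 2)) = x 0
    rw [hw2]
    have e1 : (1 : ℝ) - (rho - x 0) / (rho + x 0) = 2 * x 0 / (rho + x 0) := by field_simp; ring
    have e2 : (1 : ℝ) + (rho - x 0) / (rho + x 0) = 2 * rho / (rho + x 0) := by field_simp; ring
    rw [e1, e2]
    have : (2 * x 0 / (rho + x 0)) / (2 * rho / (rho + x 0)) = x 0 / rho := by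
      field_simp
    rw [this, mul_div_cancel₀ (x 0) rho_pos.ne']
  · -- the pulled-back integrand
    obtain ⟨hw0, hw1⟩ := mem_unitIoo.1 hw
    have hlift : lift₁ (fun s => rho * ((1 - s ^ 2) / (1 + s ^ 2))) w 0 =
        rho * ((1 - w 0 ^ 2) / (1 + w 0 ^ 2)) := rfl
    rw [hpq w hw, hr _ hwd, hlift, mul_pow, rho_sq]
    have hsq : √(3 / 4 - 3 / 4 * ((1 - w 0 ^ 2) / (1 + w 0 ^ 2)) ^ 2) = 2 * rho * w 0 / (1 + w 0 ^ 2) := by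
      have h : 3 / 4 - 3 / 4 * ((1 - w 0 ^ 2) / (1 + w 0 ^ 2)) ^ 2 = (2 * rho * w 0 / (1 + w 0 ^ 2)) ^ 2 := by
        simp only [div_pow, mul_pow, rho_sq]
        have hd := (hden (w 0)).ne'
        field_simp
        ring
      rw [h]
      exact Real.sqrt_sq (div_pos (mul_pos (mul_pos two_pos rho_pos) hw0) (hden _)).le
    have habs : |rho * (-(4 * w 0) / (1 + w 0 ^ 2) ^ 2)| = rho * (4 * w 0) / (1 + w 0 ^ 2) ^ 2 := by
      rw [show rho * (-(4 * w 0) / (1 + w 0 ^ 2) ^ 2) = -(rho * (4 * w 0) / (1 + w 0 ^ 2) ^ 2) by ring,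
        abs_neg, abs_of_pos (div_pos (mul_pos rho_pos (by linarith)) (pow_pos (hden _) 2))]
    rw [hsq, habs]
    have hAB : 2 * rho * w 0 / (1 + w 0 ^ 2) * (rho * (4 * w 0) / (1 + w 0 ^ 2) ^ 2) =
        6 * w 0 ^ 2 / (1 + w 0 ^ 2) ^ 3 := by
      have hd := (hden (w 0)).ne'
      rw [div_mul_div_comm, show 2 * rho * w 0 * (rho * (4 * w 0)) = 8 * rho ^ 2 * w 0 ^ 2 by ring,
        rho_sq]
      field_simp
      ring
    rw [mul_assoc, hAB]

end Summit.KontsevichZagierPeriods.RootDecompWalshStrata.ConicDescent.BallCube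

end
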